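import Summits.CriticalPhenomena.CardyFormulaZ2.Theorems.CardyComplexConeSLESixFamiliesGiveCardySmoothMarkFamiliesPart8
import HarnessLib

/-!
# Smooth-mark discretisation families, part 9: the labelling at a fixed small mesh (abstract assembly)

Helper file for stub `stub_smoothMarkFamilies` of line `collar-touch-sandwich` of crux
`SLESixFamiliesGiveCardy` (stmt-CriticalPhenomena-9654).  At a fixed mesh `δ` we are given a label
`A` on sites (`A x` = "`x` goes to the arc `D.arc 0`"), per-mark tests `C i` and per-mark cut edges
`{z i 0, z i 1}`, with the properties established in part 8 (near the mark `A` is the test `C i`, a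
shared nearest frontier point forces equal tests, the cut edge joins two boundary sites with
opposite tests near the mark, bounds exactly one inner face and is the only such edge nearby) and
far from the marks `A` is the Voronoi comparison of the two arcs, which there is read off ANY nearest
frontier point (arc gap).  We derive the hypotheses of the labelling reduction
`zdDiscretisationFamily_of_labelling` for `SA = {A} ∩ zdBoundary`, `SB = {¬A} ∩ zdBoundary`:
agreement of labels of sites with a common nearest frontier point (`label_agree`), no forcing
(`not_covered`), the crossing edges are exactly the two cut edges (`crossing_eq`), sides, and the
`5δ`-closeness of the discrete marked points to the marks.
-/

noncomputable section

open Set Metric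
open Literature.Probability Literature.Probability.RandomPlanarGeometry
  Literature.Probability.LatticeModels Literature.Probability.Percolation

namespace Summit.CriticalPhenomena.CardyFormulaZ2.Cruxes.SLESixFamiliesGiveCardy.CollarTouchSandwich

namespace SmoothMark

section Assembly

variable (D : DobrushinDomain) {δ R c₀ : ℝ} (A : Site 2 → Prop) (C : Fin 2 → Site 2 → Prop)
  (z : Fin 2 → Fin 2 → Site 2)
  (hδ : 0 < δ) (hδR : 128 * δ ≤ R) (hR01 : R ≤ dist (D.pt 0) (D.pt 1))
  (hgap : ∀ j : Fin 2, ∀ w ∈ D.arc j, R / 32 ≤ dist w (D.pt 0) → R / 32 ≤ dist w (D.pt 1) →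
    c₀ ≤ infDist w (D.arc (j + 1))) (hc₀ : 8 * δ < c₀)
  (hAvor : ∀ x, 6 * δ ≤ dist (meshPoint δ x) (D.pt 0) → 6 * δ ≤ dist (meshPoint δ x) (D.pt 1) →
    (A x ↔ infDist (meshPoint δ x) (D.arc 0) ≤ infDist (meshPoint δ x) (D.arc 1)))
  (hAC : ∀ i : Fin 2, ∀ x ∈ (⟨D.carrier, δ, ∅, ∅⟩ : DiscreteDobrushin).zdBoundary,
    dist (meshPoint δ x) (D.pt i) < R / 4 - 2 * δ → (A x ↔ C i x))
  (hCC : ∀ i : Fin 2, ∀ x ∈ (⟨D.carrier, δ, ∅, ∅⟩ : DiscreteDobrushin).zdBoundary,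
    ∀ y ∈ (⟨D.carrier, δ, ∅, ∅⟩ : DiscreteDobrushin).zdBoundary,
    dist (meshPoint δ x) (D.pt i) < R / 4 - 2 * δ → dist (meshPoint δ y) (D.pt i) < R / 4 - 2 * δ →
    ∀ q ∈ frontier D.carrier, dist (meshPoint δ x) q = infDist (meshPoint δ x) (frontier D.carrier) →
    dist (meshPoint δ y) q = infDist (meshPoint δ y) (frontier D.carrier) → (C i x ↔ C i y))
  (hz : ∀ i : Fin 2, z i 0 ∈ (⟨D.carrier, δ, ∅, ∅⟩ : DiscreteDobrushin).zdBoundary ∧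
    z i 1 ∈ (⟨D.carrier, δ, ∅, ∅⟩ : DiscreteDobrushin).zdBoundary ∧
    (discreteDomainGraph D.carrier δ).Adj (z i 0) (z i 1) ∧
    dist (meshPoint δ (z i 0)) (D.pt i) ≤ 5 * δ ∧ dist (meshPoint δ (z i 1)) (D.pt i) ≤ 5 * δ ∧
    ¬ (C i (z i 0) ↔ C i (z i 1)))
  (hzu : ∀ i : Fin 2, ∀ x y, (discreteDomainGraph D.carrier δ).Adj x y →
    x ∈ (⟨D.carrier, δ, ∅, ∅⟩ : DiscreteDobrushin).zdBoundary →
    y ∈ (⟨D.carrier, δ, ∅, ∅⟩ : DiscreteDobrushin).zdBoundary →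
    dist (meshPoint δ x) (D.pt i) < R / 4 - 4 * δ → ¬ (C i x ↔ C i y) → s(x, y) = s(z i 0, z i 1))

/-- The distance to the frontier of a boundary site of the canonical data is at most `2δ`.
[folklore] -/
theorem infDist_frontier_le' (hδ : 0 < δ) {x : Site 2}
    (hx : x ∈ (⟨D.carrier, δ, ∅, ∅⟩ : DiscreteDobrushin).zdBoundary) :
    infDist (meshPoint δ x) (frontier D.carrier) ≤ 2 * δ :=
  infDist_frontier_le_of_mem_zdBoundary (E := ⟨D.carrier, δ, ∅, ∅⟩) D.isOpen hδ.le hx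

include hδ hδR hgap hc₀ hAvor hAC hCC in
/-- **Labels of sites with a common nearest frontier point agree.** [folklore] -/
theorem label_agree {x y : Site 2} (hx : x ∈ (⟨D.carrier, δ, ∅, ∅⟩ : DiscreteDobrushin).zdBoundary)
    (hy : y ∈ (⟨D.carrier, δ, ∅, ∅⟩ : DiscreteDobrushin).zdBoundary) {q : ℂ} (hq : q ∈ frontier D.carrier)
    (hqx : dist (meshPoint δ x) q = infDist (meshPoint δ x) (frontier D.carrier))
    (hqy : dist (meshPoint δ y) q = infDist (meshPoint δ y) (frontier D.carrier))
    (hxy : dist (meshPoint δ x) (meshPoint δ y) ≤ 4 * δ) : A x ↔ A y := by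
  by_cases hnear : ∃ i : Fin 2, dist (meshPoint δ x) (D.pt i) < R / 4 - 6 * δ
  · obtain ⟨i, hi⟩ := hnear
    have hyi : dist (meshPoint δ y) (D.pt i) < R / 4 - 2 * δ := by
      have := dist_triangle (meshPoint δ y) (meshPoint δ x) (D.pt i)
      rw [dist_comm (meshPoint δ y) (meshPoint δ x)] at this
      linarith
    rw [hAC i x hx (by linarith), hAC i y hy hyi]
    exact hCC i x hx y hy (by linarith) hyi q hq hqx hqy
  · push Not at hnear
    have hx6 : ∀ i : Fin 2, 6 * δ ≤ dist (meshPoint δ x) (D.pt i) := fun i => by linarith [hnear i]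
    have hy6 : ∀ i : Fin 2, 6 * δ ≤ dist (meshPoint δ y) (D.pt i) := fun i => by
      have := dist_triangle (meshPoint δ x) (meshPoint δ y) (D.pt i)
      linarith [hnear i]
    rw [hAvor x (hx6 0) (hx6 1), hAvor y (hy6 0) (hy6 1)]
    have hρ : 4 * δ ≤ R / 16 := by linarith
    have hc : 4 * δ < c₀ := by linarith
    have hgap' : ∀ j : Fin 2, ∀ w ∈ D.arc j, R / 16 / 2 ≤ dist w (D.pt 0) → R / 16 / 2 ≤ dist w (D.pt 1) →
        c₀ ≤ infDist w (D.arc (j + 1)) := fun j w hw h0 h1 => hgap j w hw (by linarith) (by linarith)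
    rw [voronoi_iff_of_nearest_far D hδ.le hρ hc hgap' hx (by linarith [hnear 0]) (by linarith [hnear 1]) hq hqx,
      voronoi_iff_of_nearest_far D hδ.le hρ hc hgap' hy ?_ ?_ hq hqy]
    · have := dist_triangle (meshPoint δ x) (meshPoint δ y) (D.pt 0); linarith [hnear 0]
    · have := dist_triangle (meshPoint δ x) (meshPoint δ y) (D.pt 1); linarith [hnear 1]

include hδ hδR hgap hc₀ hAvor hAC hCC in
/-- **No forcing.** The disc `closedBall (δy) (infDist (δy) ∂D)` of a boundary site is not covered by
the discs of the boundary sites with the other label: a nearest frontier point of `y` would be a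
nearest frontier point of one of them, whose label would then agree with that of `y`. [folklore] -/
theorem not_covered {y : Site 2} (hy : y ∈ (⟨D.carrier, δ, ∅, ∅⟩ : DiscreteDobrushin).zdBoundary)
    {X : Set (Site 2)} (hX : X ⊆ (⟨D.carrier, δ, ∅, ∅⟩ : DiscreteDobrushin).zdBoundary)
    (hlab : ∀ x ∈ X, ¬ (A x ↔ A y)) :
    ¬ closedBall (meshPoint δ y) (infDist (meshPoint δ y) (frontier D.carrier)) ⊆
      ⋃ x ∈ X, closedBall (meshPoint δ x) (infDist (meshPoint δ x) (frontier D.carrier)) := by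
  intro hcov
  have hfne : (frontier D.carrier).Nonempty := ⟨_, D.pt_mem_frontier 0⟩
  obtain ⟨q, hq, hqy⟩ := isClosed_frontier.exists_infDist_eq_dist hfne (meshPoint δ y)
  have hqB : q ∈ closedBall (meshPoint δ y) (infDist (meshPoint δ y) (frontier D.carrier)) := by
    rw [mem_closedBall, dist_comm, ← hqy]
  obtain ⟨x, hxX, hqx⟩ : ∃ x ∈ X, q ∈ closedBall (meshPoint δ x) (infDist (meshPoint δ x) (frontier D.carrier)) := by
    simpa only [mem_iUnion, exists_prop] using hcov hqB
  rw [mem_closedBall, dist_comm] at hqx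
  have hqx' : dist (meshPoint δ x) q = infDist (meshPoint δ x) (frontier D.carrier) :=
    le_antisymm hqx (infDist_le_dist_of_mem hq)
  refine hlab x hxX (label_agree D A C hδ hδR hgap hc₀ hAvor hAC hCC (hX hxX) hy hq hqx' hqy.symm ?_)
  calc dist (meshPoint δ x) (meshPoint δ y) ≤ dist (meshPoint δ x) q + dist q (meshPoint δ y) := dist_triangle _ _ _
    _ ≤ 2 * δ + 2 * δ := by
        refine add_le_add ?_ ?_
        · rw [hqx']; exact infDist_frontier_le' D hδ (hX hxX)
        · rw [dist_comm, ← hqy]; exact infDist_frontier_le' D hδ hy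
    _ = 4 * δ := by ring

include hδ hδR hgap hc₀ hAvor hAC hz hzu in
/-- **The crossing edges are exactly the two cut edges.** [folklore] -/
theorem crossing_eq :
    {e | e ∈ (discreteDomainGraph D.carrier δ).edgeSet ∧
      (∃ x ∈ e, x ∈ {x | x ∈ (⟨D.carrier, δ, ∅, ∅⟩ : DiscreteDobrushin).zdBoundary ∧ A x}) ∧
      ∃ y ∈ e, y ∈ {x | x ∈ (⟨D.carrier, δ, ∅, ∅⟩ : DiscreteDobrushin).zdBoundary ∧ ¬ A x}} =
    {s(z 0 0, z 0 1), s(z 1 0, z 1 1)} := by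
  ext e
  simp only [mem_setOf_eq, mem_insert_iff, mem_singleton_iff]
  constructor
  · rintro ⟨he, ⟨x, hxe, hx, hAx⟩, y, hye, hy, hAy⟩
    have hne : x ≠ y := fun h => hAy (h ▸ hAx)
    have hexy : e = s(x, y) := (Sym2.mem_and_mem_iff hne).1 ⟨hxe, hye⟩
    subst hexy
    rw [SimpleGraph.mem_edgeSet] at he
    have hzd := (meshGraph_adj_iff.1 (discreteDomainGraph_adj_iff.1 he).1).1
    have hdxy : dist (meshPoint δ x) (meshPoint δ y) = δ := by rw [dist_meshPoint_of_adj hzd, abs_of_pos hδ]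
    by_cases hnear : ∃ i : Fin 2, dist (meshPoint δ x) (D.pt i) < R / 4 - 6 * δ
    · obtain ⟨i, hi⟩ := hnear
      have hyi : dist (meshPoint δ y) (D.pt i) < R / 4 - 2 * δ := by
        have := dist_triangle (meshPoint δ y) (meshPoint δ x) (D.pt i)
        rw [dist_comm (meshPoint δ y) (meshPoint δ x)] at this
        linarith
      rw [hAC i x hx (by linarith)] at hAx
      rw [hAC i y hy hyi] at hAy
      have h := hzu i x y he hx hy (by linarith) (fun h => hAy (h.1 hAx))
      fin_cases i
      · exact Or.inl h
      · exact Or.inr h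
    · exfalso
      push Not at hnear
      have hx6 : ∀ i : Fin 2, 6 * δ ≤ dist (meshPoint δ x) (D.pt i) := fun i => by linarith [hnear i]
      have hy6 : ∀ i : Fin 2, 6 * δ ≤ dist (meshPoint δ y) (D.pt i) := fun i => by
        have := dist_triangle (meshPoint δ x) (meshPoint δ y) (D.pt i)
        linarith [hnear i]
      rw [hAvor x (hx6 0) (hx6 1)] at hAx
      rw [hAvor y (hy6 0) (hy6 1)] at hAy
      have hfne : (frontier D.carrier).Nonempty := ⟨_, D.pt_mem_frontier 0⟩
      obtain ⟨qx, hqx, hqxd⟩ := isClosed_frontier.exists_infDist_eq_dist hfne (meshPoint δ x)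
      obtain ⟨qy, hqy, hqyd⟩ := isClosed_frontier.exists_infDist_eq_dist hfne (meshPoint δ y)
      have hρ : 4 * δ ≤ R / 16 := by linarith
      have hc : 4 * δ < c₀ := by linarith
      have hgap' : ∀ j : Fin 2, ∀ w ∈ D.arc j, R / 16 / 2 ≤ dist w (D.pt 0) → R / 16 / 2 ≤ dist w (D.pt 1) →
          c₀ ≤ infDist w (D.arc (j + 1)) := fun j w hw h0 h1 => hgap j w hw (by linarith) (by linarith)
      rw [voronoi_iff_of_nearest_far D hδ.le hρ hc hgap' hx (by linarith [hnear 0]) (by linarith [hnear 1])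
        hqx hqxd.symm] at hAx
      rw [voronoi_iff_of_nearest_far D hδ.le hρ hc hgap' hy
        (by have := dist_triangle (meshPoint δ x) (meshPoint δ y) (D.pt 0); linarith [hnear 0])
        (by have := dist_triangle (meshPoint δ x) (meshPoint δ y) (D.pt 1); linarith [hnear 1])
        hqy hqyd.symm] at hAy
      have hqy1 : qy ∈ D.arc 1 := ((mem_frontier_iff_mem_arc D qy).1 hqy).resolve_left hAy
      have hdx : dist (meshPoint δ x) qx ≤ 2 * δ := by rw [← hqxd]; exact infDist_frontier_le' D hδ hx
      have hdy : dist (meshPoint δ y) qy ≤ 2 * δ := by rw [← hqyd]; exact infDist_frontier_le' D hδ hy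
      have hqq : dist qx qy ≤ 5 * δ := by
        have h1 := dist_triangle qx (meshPoint δ x) qy
        have h2 := dist_triangle (meshPoint δ x) (meshPoint δ y) qy
        rw [dist_comm qx (meshPoint δ x)] at h1
        linarith
      have hfar : ∀ m : Fin 2, R / 32 ≤ dist qx (D.pt m) := fun m => by
        have := dist_triangle (meshPoint δ x) qx (D.pt m)
        linarith [hnear m]
      have h1 := hgap 0 qx hAx (hfar 0) (hfar 1)
      have h2 := infDist_le_dist_of_mem (x := qx) (show qy ∈ D.arc (0 + 1) by simpa using hqy1)
      linarith
  · -- the two cut edges are crossing edges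
    have key : ∀ i : Fin 2, s(z i 0, z i 1) ∈ (discreteDomainGraph D.carrier δ).edgeSet ∧
        (∃ x ∈ s(z i 0, z i 1), x ∈ (⟨D.carrier, δ, ∅, ∅⟩ : DiscreteDobrushin).zdBoundary ∧ A x) ∧
        ∃ y ∈ s(z i 0, z i 1), y ∈ (⟨D.carrier, δ, ∅, ∅⟩ : DiscreteDobrushin).zdBoundary ∧ ¬ A y := by
      intro i
      obtain ⟨h0, h1, hadj, hd0, hd1, hC⟩ := hz i
      have hA0 := hAC i _ h0 (by linarith)
      have hA1 := hAC i _ h1 (by linarith)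
      refine ⟨(SimpleGraph.mem_edgeSet _).2 hadj, ?_⟩
      by_cases hAz : A (z i 0)
      · refine ⟨⟨z i 0, Sym2.mem_mk_left _ _, h0, hAz⟩, z i 1, Sym2.mem_mk_right _ _, h1, fun hAz' => ?_⟩
        exact hC ⟨fun _ => hA1.1 hAz', fun _ => hA0.1 hAz⟩
      · refine ⟨⟨z i 1, Sym2.mem_mk_right _ _, h1, ?_⟩, z i 0, Sym2.mem_mk_left _ _, h0, hAz⟩
        by_contra hAz'
        exact hC ⟨fun h => absurd (hA0.2 h) hAz, fun h => absurd (hA1.2 h) hAz'⟩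
    rintro (rfl | rfl)
    · exact key 0
    · exact key 1

include hδ hδR hR01 hz in
/-- The two cut edges are distinct (their endpoints are near different marks). [folklore] -/
theorem cut_edges_ne : s(z 0 0, z 0 1) ≠ s(z 1 0, z 1 1) := by
  intro h
  have hmem : z 0 0 ∈ s(z 1 0, z 1 1) := by rw [← h]; exact Sym2.mem_mk_left _ _
  obtain ⟨-, -, -, hd0, -, -⟩ := hz 0
  obtain ⟨-, -, -, hd1, hd1', -⟩ := hz 1
  have key : ∀ w, dist (meshPoint δ w) (D.pt 1) ≤ 5 * δ → z 0 0 ≠ w := by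
    intro w hw heq
    rw [← heq] at hw
    have := dist_triangle (D.pt 0) (meshPoint δ (z 0 0)) (D.pt 1)
    rw [dist_comm (D.pt 0) (meshPoint δ (z 0 0))] at this
    linarith
  rcases Sym2.mem_iff.1 hmem with h' | h'
  · exact key _ hd1 h'
  · exact key _ hd1' h'

include hz in
/-- **The discrete marked points are within `5δ` of the marks.** [folklore] -/
theorem hausdorffEDist_medialPoint_le :
    hausdorffEDist (medialPoint δ '' {s(z 0 0, z 0 1), s(z 1 0, z 1 1)}) {D.pt 0, D.pt 1} ≤
      ENNReal.ofReal (5 * δ) := by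
  have hmid : ∀ i : Fin 2, dist (medialPoint δ s(z i 0, z i 1)) (D.pt i) ≤ 5 * δ := by
    intro i
    obtain ⟨-, -, -, hd0, hd1, -⟩ := hz i
    rw [medialPoint_mk, dist_eq_norm]
    rw [dist_eq_norm] at hd0 hd1
    have : (meshPoint δ (z i 0) + meshPoint δ (z i 1)) / 2 - D.pt i =
        ((meshPoint δ (z i 0) - D.pt i) + (meshPoint δ (z i 1) - D.pt i)) / 2 := by ring
    rw [this, norm_div, Complex.norm_two]
    linarith [norm_add_le (meshPoint δ (z i 0) - D.pt i) (meshPoint δ (z i 1) - D.pt i)]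
  rw [image_pair]
  refine hausdorffEDist_le_of_mem_edist ?_ ?_
  · rintro m (rfl | rfl)
    · exact ⟨D.pt 0, mem_insert _ _, by rw [edist_dist]; exact ENNReal.ofReal_le_ofReal (hmid 0)⟩
    · exact ⟨D.pt 1, mem_insert_of_mem _ (mem_singleton _), by
        rw [edist_dist]; exact ENNReal.ofReal_le_ofReal (hmid 1)⟩
  · rintro q (rfl | rfl)
    · exact ⟨_, mem_insert _ _, by rw [edist_dist, dist_comm]; exact ENNReal.ofReal_le_ofReal (hmid 0)⟩
    · exact ⟨_, mem_insert_of_mem _ (mem_singleton _), by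
        rw [edist_dist, dist_comm]; exact ENNReal.ofReal_le_ofReal (hmid 1)⟩

end Assembly

end SmoothMark

/-! ### Registered sub-goal (one-line signature, verbatim) -/

/-- **Registered sub-goal `smoothMark_part9` of `stub_smoothMarkFamilies`**: the midpoints of the two cut edges are within `5δ` of the marked points. [folklore] -/
theorem smoothMark_part9 : ∀ (D : DobrushinDomain) (δ : ℝ) (C : Fin 2 → Site 2 → Prop) (z : Fin 2 → Fin 2 → Site 2), (∀ i : Fin 2, z i 0 ∈ (⟨D.carrier, δ, ∅, ∅⟩ : DiscreteDobrushin).zdBoundary ∧ z i 1 ∈ (⟨D.carrier, δ, ∅, ∅⟩ : DiscreteDobrushin).zdBoundary ∧ (discreteDomainGraph D.carrier δ).Adj (z i 0) (z i 1) ∧ dist (meshPoint δ (z i 0)) (D.pt i) ≤ 5 * δ ∧ dist (meshPoint δ (z i 1)) (D.pt i) ≤ 5 * δ ∧ ¬ (C i (z i 0) ↔ C i (z i 1))) → Metric.hausdorffEDist (medialPoint δ '' {s(z 0 0, z 0 1), s(z 1 0, z 1 1)}) {D.pt 0, D.pt 1} ≤ ENNReal.ofReal (5 * δ) :=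
  fun D _ C z hz => SmoothMark.hausdorffEDist_medialPoint_le D C z hz

end Summit.CriticalPhenomena.CardyFormulaZ2.Cruxes.SLESixFamiliesGiveCardy.CollarTouchSandwich

end
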